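import Literature.Analysis.FluidPDE.CylindricalCutoff
import Literature.Analysis.FluidPDE.AxisymmetricVorticityTransport
import Literature.Analysis.FunctionSpaces.SmoothParametricIntegral
import Mathlib.Analysis.Calculus.ParametricIntervalIntegral
import Mathlib.Analysis.SpecialFunctions.Complex.Arg
import HarnessLib

/-!
# Lei–Ren–Zhang 2019, §§2–3: the angular stream potential of a periodic axisymmetric drift

Analysis/FluidPDE file on the discharge path of the named fact
`Literature.Analysis.FluidPDE.leiRenZhang2019_liouville_periodic` (Z. Lei, X. Ren, Q. S. Zhang,
arXiv:1902.11229 = Math. Ann. 383 (2022), Theorem 1.1). In the energy estimates of §2 ((2.5):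
"`∫ v_r ∂ᵣψ² Φ² = −∫ ∂_z(L_θ − L_θ(r,0,t)) ∂ᵣ(ψ²)Φ² = 2∫(L_θ(r,z,t) − L_θ(r,0,t))∂ᵣψ²∂_zΦΦ`")
and §3 ((3.4), (3.15)) the radial drift `v_r = −∂_z L_θ` is written as the `z`-derivative of the
angular stream function normalised at `z = 0`, i.e. of `−∫_0^z v_r(r, z') dz'`, and the
`z`-integration by parts over one period uses that this primitive is again `z`-periodic — which
holds because the period average of `r v_r` vanishes for a divergence-free axisymmetric periodic
field (`(1/r)∂ᵣ(r v̄_r) = −avg ∂_z v_z = 0`, `r v̄_r → 0` at the axis).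

In the tree's `H`-calculus (`PeriodicSwirlEnergy.energy_inequality_periodic`, hypotheses `hΦz`,
`hΦp`, `hΦb`) the potential is used in the form `Φ(x) = ∫_0^{x₂} ⟪U(x_h + ζe_z), x_h⟫ dζ`
(`= −r (L_θ − L_θ(r,0))`), with `∂_zΦ = ⟪U, x_h⟫ = r U_r`, `|Φ| ≤ P‖U‖_∞ r`, axially periodic:

* `axialDriftPotential U x = ∫_0^{x 2} ⟪U (horizPart x + ζ • eZ), horizPart x⟫ dζ`;
* `contDiff_axialDriftPotential` (smooth for smooth `U`), `fderiv_axialDriftPotential_eZ`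
  (`∂_zΦ = ⟪U x, x_h⟫`), `abs_axialDriftPotential_le` (`|Φ x| ≤ C_U |x₂| r`);
* `intervalIntegral_inner_horizPart_eq_zero` — **the period average of `r U_r` vanishes** for
  `U ∈ C¹` bounded with bounded derivative, divergence free, axisymmetric, axially `P`-periodic;
* `isAxiallyPeriodic_axialDriftPotential` and the bound `|Φ x| ≤ C_U P r`
  (`abs_axialDriftPotential_le_mul_cylRadius`).

## References

* Z. Lei, X. Ren, Q. S. Zhang, arXiv:1902.11229, §2 (2.5) and §3 (3.4), (3.15) (arXiv pp. 5, 7, 8):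
  the angular stream function `L_θ − L_θ(r,0,t)`, `v_r = −∂_z(L_θ − L_θ(r,0,t))`. [LeiRenZhang2019]
-/

noncomputable section

open MeasureTheory Set Function Filter Metric intervalIntegral
open _root_.Topology
open scoped InnerProductSpace RealInnerProductSpace ContDiff

namespace Literature.Analysis.FluidPDE

/-- **The angular stream potential** of a drift `U` (Lei–Ren–Zhang 2019, (2.5):
`−r(L_θ(r,z) − L_θ(r,0))`, `v_r = −∂_z L_θ`): `Φ(x) = ∫_0^{x₂} ⟪U(x_h + ζ e_z), x_h⟫ dζ`, the
primitive in `z`, vanishing on `{z = 0}`, of `r U_r = ⟪U, x_h⟫`. [cite: LeiRenZhang2019, §2 (2.5) (the angular stream function L_θ − L_θ(r,0,t), v_r = −∂_z(L_θ − L_θ(r,0,t))), arXiv p. 5] -/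
def axialDriftPotential (U : EuclideanSpace ℝ (Fin 3) → EuclideanSpace ℝ (Fin 3))
    (x : EuclideanSpace ℝ (Fin 3)) : ℝ :=
  ∫ ζ in (0 : ℝ)..(x 2), ⟪U (horizPart x + ζ • eZ), horizPart x⟫

namespace LeiRenZhang2019

variable {U : EuclideanSpace ℝ (Fin 3) → EuclideanSpace ℝ (Fin 3)}

/-! ### Plumbing -/

/-- `(x + t e_z)₂ = x₂ + t`. [folklore] -/
private theorem add_smul_eZ_apply_two_pdp (x : EuclideanSpace ℝ (Fin 3)) (t : ℝ) : (x + t • eZ) 2 = x 2 + t := by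
  simp [eZ]

/-- `(t e_z)₂ = t`, `(t e_z)₀ = (t e_z)₁ = 0`. [folklore] -/
private theorem smul_eZ_apply_pdp (t : ℝ) :
    (t • (eZ : EuclideanSpace ℝ (Fin 3))) 2 = t ∧ (t • (eZ : EuclideanSpace ℝ (Fin 3))) 0 = 0 ∧
      (t • (eZ : EuclideanSpace ℝ (Fin 3))) 1 = 0 := by
  refine ⟨by simp [eZ], by simp [eZ], by simp [eZ]⟩

/-- Rotations fix the axis vector. [folklore] -/
private theorem rotZ_smul_eZ_pdp (θ t : ℝ) : rotZ θ (t • (eZ : EuclideanSpace ℝ (Fin 3))) = t • eZ := by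
  ext i
  fin_cases i <;> simp [eZ]

/-- Rotations are additive. [folklore] -/
private theorem rotZ_add_vec_pdp (θ : ℝ) (a b : EuclideanSpace ℝ (Fin 3)) : rotZ θ (a + b) = rotZ θ a + rotZ θ b := by
  ext i
  fin_cases i <;> simp <;> ring

/-- Rotations commute with scalars. [folklore] -/
private theorem rotZ_smul_pdp (θ c : ℝ) (a : EuclideanSpace ℝ (Fin 3)) : rotZ θ (c • a) = c • rotZ θ a := by
  ext i
  fin_cases i <;> simp <;> ring

/-- Rotations preserve inner products. [folklore] -/
private theorem inner_rotZ_rotZ_pdp (θ : ℝ) (a b : EuclideanSpace ℝ (Fin 3)) : ⟪rotZ θ a, rotZ θ b⟫ = ⟪a, b⟫ := by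
  simp only [PiLp.inner_apply, Fin.sum_univ_three, rotZ_apply_zero, rotZ_apply_one, rotZ_apply_two,
    RCLike.inner_apply, conj_trivial]
  linear_combination (b 0 * a 0 + b 1 * a 1) * Real.sin_sq_add_cos_sq θ

/-- `R_{−θ} R_θ = id`. [folklore] -/
private theorem rotZ_neg_rotZ_pdp (θ : ℝ) (a : EuclideanSpace ℝ (Fin 3)) : rotZ (-θ) (rotZ θ a) = a := by
  rw [← rotZ_add, neg_add_cancel, rotZ_zero]

/-- **Polar angle**: a horizontal vector is a rotation of `r e₀`. [folklore] -/
private theorem exists_eq_rotZ_smul_pdp {y : EuclideanSpace ℝ (Fin 3)} (hy : y 2 = 0) :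
    ∃ θ : ℝ, y = rotZ θ (cylRadius y • EuclideanSpace.single 0 1) := by
  suffices h : ∃ θ : ℝ, rotZ θ y = cylRadius y • EuclideanSpace.single 0 1 by
    obtain ⟨θ, hθ⟩ := h
    exact ⟨-θ, by rw [← hθ, rotZ_neg_rotZ_pdp]⟩
  by_cases hx : cylRadius y = 0
  · obtain ⟨h0, h1⟩ := (cylRadius_eq_zero_iff y).1 hx
    refine ⟨0, ?_⟩
    ext i
    fin_cases i <;> simp [hx, h0, h1, hy]
  · set z : ℂ := ⟨y 0, y 1⟩ with hz
    have hnorm : ‖z‖ = cylRadius y := by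
      rw [Complex.norm_eq_sqrt_sq_add_sq, cylRadius]
    have hz0 : z ≠ 0 := by
      intro h
      apply hx
      rw [← hnorm, h, norm_zero]
    have hcos : Real.cos (Complex.arg z) = y 0 / cylRadius y := by
      rw [Complex.cos_arg hz0, hnorm]
    have hsin : Real.sin (Complex.arg z) = y 1 / cylRadius y := by
      rw [Complex.sin_arg, hnorm]
    have hr : cylRadius y ^ 2 = y 0 ^ 2 + y 1 ^ 2 := cylRadius_sq y
    refine ⟨-Complex.arg z, ?_⟩
    ext i
    fin_cases i
    · simp [hcos, hsin]
      field_simp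
      nlinarith [hr]
    · simp [hcos, hsin]
      field_simp
      ring
    · simp [hy]

/-- A vector fixed by the half-turn about the axis has vanishing first component. [folklore] -/
private theorem apply_zero_eq_zero_of_rotZ_pi_pdp {v : EuclideanSpace ℝ (Fin 3)} (hv : rotZ Real.pi v = v) : v 0 = 0 := by
  have h := congrArg (fun w : EuclideanSpace ℝ (Fin 3) => w 0) hv
  simp only [rotZ_apply_zero, Real.cos_pi, Real.sin_pi] at h
  linarith

/-! ### The integrand and the line `t ↦ x + t e_z` -/

section Basic

/-- The integrand `ζ ↦ ⟪U(x_h + ζ e_z), x_h⟫` is continuous. [folklore] -/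
private theorem continuous_integrand_pdp (hUc : Continuous U) (y w : EuclideanSpace ℝ (Fin 3)) :
    Continuous fun ζ : ℝ => ⟪U (y + ζ • eZ), w⟫ :=
  (hUc.comp (continuous_const.add (continuous_id.smul continuous_const))).inner continuous_const

/-- Along the axis direction the potential is the primitive:
`Φ(x + t e_z) = ∫_0^{x₂ + t} ⟪U(x_h + ζe_z), x_h⟫ dζ`. [folklore] -/
private theorem axialDriftPotential_add_smul_eZ_pdp (x : EuclideanSpace ℝ (Fin 3)) (t : ℝ) :
    axialDriftPotential U (x + t • eZ) = ∫ ζ in (0 : ℝ)..(x 2 + t), ⟪U (horizPart x + ζ • eZ), horizPart x⟫ := by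
  rw [axialDriftPotential, horizPart_add_smul_eZ, add_smul_eZ_apply_two_pdp]

/-- The line derivative: `d/dt Φ(x + t e_z)|₀ = ⟪U x, x_h⟫`. [folklore] -/
private theorem hasDerivAt_axialDriftPotential_line_pdp (hUc : Continuous U) (x : EuclideanSpace ℝ (Fin 3)) :
    HasDerivAt (fun t : ℝ => axialDriftPotential U (x + t • eZ)) ⟪U x, horizPart x⟫ 0 := by
  have hf := continuous_integrand_pdp hUc (horizPart x) (horizPart x)
  have hG : HasDerivAt (fun s : ℝ => ∫ ζ in (0 : ℝ)..s, ⟪U (horizPart x + ζ • eZ), horizPart x⟫)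
      ⟪U (horizPart x + (x 2) • eZ), horizPart x⟫ (x 2 + 0) := by
    rw [add_zero]
    exact (hf.integral_hasStrictDerivAt 0 (x 2)).hasDerivAt
  rw [horizPart_add_apply_two_smul_eZ] at hG
  have hcomp := HasDerivAt.comp_const_add (x 2) 0 hG
  have e : (fun t : ℝ => axialDriftPotential U (x + t • eZ)) =
      fun t => ∫ ζ in (0 : ℝ)..(x 2 + t), ⟪U (horizPart x + ζ • eZ), horizPart x⟫ :=
    funext fun t => axialDriftPotential_add_smul_eZ_pdp x t
  rw [e]
  exact hcomp

/-- **The bound `|Φ(x)| ≤ C_U |x₂| r`** (`|⟪U, x_h⟫| ≤ ‖U‖ r`). [cite: LeiRenZhang2019, §2 (2.5) and §3 (3.4) (boundedness of the angular stream function, v_r ∈ ∂_z L^∞), arXiv pp. 5, 7] -/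
theorem abs_axialDriftPotential_le {CU : ℝ} (hUb : ∀ x, ‖U x‖ ≤ CU) (x : EuclideanSpace ℝ (Fin 3)) :
    |axialDriftPotential U x| ≤ CU * |x 2| * cylRadius x := by
  rw [axialDriftPotential]
  have h := intervalIntegral.norm_integral_le_of_norm_le_const (a := 0) (b := x 2)
    (f := fun ζ => ⟪U (horizPart x + ζ • eZ), horizPart x⟫) (C := CU * cylRadius x) fun ζ _ => by
      rw [Real.norm_eq_abs, ← Real.norm_eq_abs]
      calc ‖⟪U (horizPart x + ζ • eZ), horizPart x⟫‖ ≤ ‖U (horizPart x + ζ • eZ)‖ * ‖horizPart x‖ :=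
            norm_inner_le_norm _ _
        _ ≤ CU * cylRadius x := by
            rw [norm_horizPart]
            exact mul_le_mul_of_nonneg_right (hUb _) (cylRadius_nonneg x)
  rw [Real.norm_eq_abs, sub_zero] at h
  calc |∫ ζ in (0 : ℝ)..(x 2), ⟪U (horizPart x + ζ • eZ), horizPart x⟫| ≤ CU * cylRadius x * |x 2| := h
    _ = CU * |x 2| * cylRadius x := by ring

end Basic

/-! ### Smoothness and the axial derivative -/

/-- **The potential is smooth** for a smooth drift: after the substitution `ζ = x₂σ`,
`Φ(x) = ∫_0^1 x₂ ⟪U(x_h + x₂σ e_z), x_h⟫ dσ` is a parametric integral of a smooth integrand. [cite: LeiRenZhang2019, §2 (2.5) (the angular stream function), arXiv p. 5] -/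
theorem contDiff_axialDriftPotential (hU : ContDiff ℝ ∞ U) : ContDiff ℝ ∞ (axialDriftPotential U) := by
  -- the substituted integrand
  set H : ℝ × EuclideanSpace ℝ (Fin 3) → ℝ := fun p =>
    p.2 2 * ⟪U (horizPart p.2 + (p.2 2 * p.1) • eZ), horizPart p.2⟫ with hH
  have hx2 : ContDiff ℝ ∞ fun p : ℝ × EuclideanSpace ℝ (Fin 3) => p.2 2 :=
    (EuclideanSpace.proj (𝕜 := ℝ) (2 : Fin 3)).contDiff.comp contDiff_snd
  have hh : ContDiff ℝ ∞ fun p : ℝ × EuclideanSpace ℝ (Fin 3) => horizPart p.2 :=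
    horizPart.contDiff.comp contDiff_snd
  have hHs : ContDiff ℝ ∞ H :=
    hx2.mul ((hU.comp (hh.add ((hx2.mul contDiff_fst).smul contDiff_const))).inner ℝ hh)
  have hsm := Literature.Analysis.FunctionSpaces.contDiff_parametric_intervalIntegral hHs 0 1
  -- `∫_0^1 x₂ g(x₂σ) dσ = ∫_0^{x₂} g`
  have e : axialDriftPotential U = fun x => ∫ σ in (0 : ℝ)..1, H (σ, x) := by
    funext x
    simp only [hH]
    rw [intervalIntegral.integral_const_mul, ← smul_eq_mul,
      intervalIntegral.smul_integral_comp_mul_left (fun ζ => ⟪U (horizPart x + ζ • eZ), horizPart x⟫) (x 2),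
      mul_zero, mul_one, axialDriftPotential]
  rw [e]
  exact hsm

/-- **The axial derivative of the potential**: `∂_zΦ(x) = DΦ(x)[e_z] = ⟪U x, x_h⟫ = r U_r`
("`v_r = −∂_z(L_θ − L_θ(r,0,t))`"). [cite: LeiRenZhang2019, §2 (2.5) and §3 (3.4), (3.15) (v_r = −∂_z(L_θ − L_θ(r,0,t))), arXiv pp. 5, 7, 8] -/
theorem fderiv_axialDriftPotential_eZ (hU : ContDiff ℝ ∞ U) (x : EuclideanSpace ℝ (Fin 3)) :
    fderiv ℝ (axialDriftPotential U) x eZ = ⟪U x, horizPart x⟫ := by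
  have hd : DifferentiableAt ℝ (axialDriftPotential U) x :=
    ((contDiff_axialDriftPotential hU).differentiable (by simp)) x
  have hline : HasDerivAt (fun t : ℝ => x + t • (eZ : EuclideanSpace ℝ (Fin 3))) eZ 0 := by
    have h := ((hasDerivAt_id (0 : ℝ)).smul_const (eZ : EuclideanSpace ℝ (Fin 3))).const_add x
    simpa using h
  have hx0 : x + (0 : ℝ) • (eZ : EuclideanSpace ℝ (Fin 3)) = x := by simp
  have hd' : DifferentiableAt ℝ (axialDriftPotential U) (x + (0 : ℝ) • (eZ : EuclideanSpace ℝ (Fin 3))) := by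
    rwa [hx0]
  have hcomp := hd'.hasFDerivAt.comp_hasDerivAt (0 : ℝ) hline
  rw [hx0] at hcomp
  exact hcomp.unique (hasDerivAt_axialDriftPotential_line_pdp hU.continuous x)

/-! ### The period average of `r U_r` vanishes -/

section Average

variable {P : ℝ}

/-- The period average `V(y) = ∫_0^P U(y + ζ e_z) dζ` of an axially periodic continuous field
is `z`-independent. [folklore] -/
private theorem periodAverage_add_smul_eZ_pdp (hper : IsAxiallyPeriodic P U)
    (y : EuclideanSpace ℝ (Fin 3)) (t : ℝ) :
    ∫ ζ in (0 : ℝ)..P, U (y + t • eZ + ζ • eZ) = ∫ ζ in (0 : ℝ)..P, U (y + ζ • eZ) := by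
  have hp : Function.Periodic (fun ζ : ℝ => U (y + ζ • eZ)) P := fun ζ => by
    have e : y + (ζ + P) • eZ = (y + ζ • eZ) + P • eZ := by rw [add_smul, add_assoc]
    simp only [e]
    exact hper (y + ζ • eZ)
  have e : (fun ζ : ℝ => U (y + t • eZ + ζ • eZ)) = fun ζ => (fun ζ' : ℝ => U (y + ζ' • eZ)) (ζ + t) := by
    funext ζ
    simp only [add_assoc, ← add_smul, add_comm t ζ]
  rw [e, intervalIntegral.integral_comp_add_right (fun ζ' : ℝ => U (y + ζ' • eZ)) t, zero_add, add_comm P t]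
  have h := hp.intervalIntegral_add_eq t 0
  rw [zero_add] at h
  exact h

/-- The period average is axisymmetric. [folklore] -/
private theorem periodAverage_rotZ_pdp (hUc : Continuous U) (hax : IsAxisymmetric U) (θ : ℝ)
    (y : EuclideanSpace ℝ (Fin 3)) :
    ∫ ζ in (0 : ℝ)..P, U (rotZ θ y + ζ • eZ) = rotZ θ (∫ ζ in (0 : ℝ)..P, U (y + ζ • eZ)) := by
  have hrot : ∀ ζ : ℝ, U (rotZ θ y + ζ • eZ) = rotZL θ (U (y + ζ • eZ)) := fun ζ => by
    rw [rotZL_apply, ← hax θ (y + ζ • eZ), rotZ_add_vec_pdp, rotZ_smul_eZ_pdp]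
  simp_rw [hrot]
  have hi : IntervalIntegrable (fun ζ : ℝ => U (y + ζ • eZ)) volume 0 P :=
    (hUc.comp (continuous_const.add (continuous_id.smul continuous_const) :
      Continuous fun ζ : ℝ => y + ζ • (eZ : EuclideanSpace ℝ (Fin 3)))).intervalIntegrable _ _
  rw [(rotZL θ).intervalIntegral_comp_comm hi, rotZL_apply]

/-- The period average is differentiable, with derivative the period average of `DU`. [folklore] -/
private theorem hasFDerivAt_periodAverage_pdp (hU : ContDiff ℝ 1 U) {C1 : ℝ} (hDU : ∀ x, ‖fderiv ℝ U x‖ ≤ C1)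
    (y : EuclideanSpace ℝ (Fin 3)) :
    HasFDerivAt (fun y : EuclideanSpace ℝ (Fin 3) => ∫ ζ in (0 : ℝ)..P, U (y + ζ • eZ))
      (∫ ζ in (0 : ℝ)..P, fderiv ℝ U (y + ζ • eZ)) y := by
  have hUc : Continuous U := hU.continuous
  have hUd : Differentiable ℝ U := hU.differentiable one_ne_zero
  have hDc : Continuous (fderiv ℝ U) := hU.continuous_fderiv one_ne_zero
  have hline : ∀ y' : EuclideanSpace ℝ (Fin 3), Continuous fun ζ : ℝ => y' + ζ • (eZ : EuclideanSpace ℝ (Fin 3)) :=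
    fun y' => continuous_const.add (continuous_id.smul continuous_const)
  refine intervalIntegral.hasFDerivAt_integral_of_dominated_of_fderiv_le (μ := volume)
    (F := fun (y' : EuclideanSpace ℝ (Fin 3)) (ζ : ℝ) => U (y' + ζ • eZ))
    (F' := fun (y' : EuclideanSpace ℝ (Fin 3)) (ζ : ℝ) => fderiv ℝ U (y' + ζ • eZ))
    (bound := fun _ => C1) (s := univ) univ_mem ?_ ?_ ?_ ?_ ?_ ?_
  · exact Eventually.of_forall fun y' => ((hUc.comp (hline y')).aestronglyMeasurable).restrict
  · exact (hUc.comp (hline y)).intervalIntegrable _ _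
  · exact ((hDc.comp (hline y)).aestronglyMeasurable).restrict
  · exact ae_of_all _ fun ζ _ y' _ => hDU _
  · exact intervalIntegrable_const
  · refine ae_of_all _ fun ζ _ y' _ => ?_
    have h := (hUd (y' + ζ • eZ)).hasFDerivAt.comp y' ((hasFDerivAt_id y').add_const (ζ • eZ))
    rwa [ContinuousLinearMap.comp_id] at h

/-- The period average is divergence free. [folklore] -/
private theorem divergence_periodAverage_pdp (hU : ContDiff ℝ 1 U) {C1 : ℝ} (hDU : ∀ x, ‖fderiv ℝ U x‖ ≤ C1)
    (hdiv : VectorCalculus.IsDivFree U) (y : EuclideanSpace ℝ (Fin 3)) :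
    VectorCalculus.divergence (fun y : EuclideanSpace ℝ (Fin 3) => ∫ ζ in (0 : ℝ)..P, U (y + ζ • eZ)) y = 0 := by
  classical
  have hDc : Continuous (fderiv ℝ U) := hU.continuous_fderiv one_ne_zero
  have hline : Continuous fun ζ : ℝ => y + ζ • (eZ : EuclideanSpace ℝ (Fin 3)) :=
    continuous_const.add (continuous_id.smul continuous_const)
  set b := EuclideanSpace.basisFun (Fin 3) ℝ with hb
  rw [divergence_eq_sum_inner_fderiv b, (hasFDerivAt_periodAverage_pdp hU hDU y).fderiv]
  have hDi : IntervalIntegrable (fun ζ : ℝ => fderiv ℝ U (y + ζ • eZ)) volume 0 P :=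
    (hDc.comp hline).intervalIntegrable _ _
  have happly : ∀ i, (∫ ζ in (0 : ℝ)..P, fderiv ℝ U (y + ζ • eZ)) (b i) =
      ∫ ζ in (0 : ℝ)..P, fderiv ℝ U (y + ζ • eZ) (b i) := fun i =>
    ((ContinuousLinearMap.apply ℝ (EuclideanSpace ℝ (Fin 3)) (b i)).intervalIntegral_comp_comm hDi).symm
  have hinner : ∀ i, ⟪b i, ∫ ζ in (0 : ℝ)..P, fderiv ℝ U (y + ζ • eZ) (b i)⟫ =
      ∫ ζ in (0 : ℝ)..P, ⟪b i, fderiv ℝ U (y + ζ • eZ) (b i)⟫ := fun i =>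
    ((innerSL ℝ (b i)).intervalIntegral_comp_comm
      (((hDc.comp hline).clm_apply continuous_const).intervalIntegrable _ _)).symm
  simp_rw [happly, hinner]
  have hI : ∀ i, IntervalIntegrable (fun ζ : ℝ => ⟪b i, fderiv ℝ U (y + ζ • eZ) (b i)⟫) volume 0 P := fun i =>
    (continuous_const.inner ((hDc.comp hline).clm_apply continuous_const)).intervalIntegrable _ _
  rw [← intervalIntegral.integral_finsetSum (fun i _ => hI i)]
  have h0 : ∀ ζ : ℝ, ∑ i, ⟪b i, fderiv ℝ U (y + ζ • eZ) (b i)⟫ = 0 := fun ζ => by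
    rw [← divergence_eq_sum_inner_fderiv b]; exact hdiv _
  simp_rw [h0]
  simp

/-- **The period average of `r U_r` vanishes along the ray `t e₀`**: with
`V(y) = ∫_0^P U(y + ζe_z)dζ` (divergence free, axisymmetric, `z`-independent) and
`g(t) = ⟪V(te₀), te₀⟫ = tV₀(te₀)`: `g' = t div V(te₀) = 0` (`DV[Jy] = JV`, `DV[e_z] = 0`),
`g(0) = 0`. [folklore] -/
private theorem inner_periodAverage_ray_pdp (hU : ContDiff ℝ 1 U) {C1 : ℝ} (hDU : ∀ x, ‖fderiv ℝ U x‖ ≤ C1)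
    (hdiv : VectorCalculus.IsDivFree U) (hax : IsAxisymmetric U) (hper : IsAxiallyPeriodic P U) (t : ℝ) :
    ⟪∫ ζ in (0 : ℝ)..P, U (t • EuclideanSpace.single 0 1 + ζ • eZ),
      t • (EuclideanSpace.single 0 1 : EuclideanSpace ℝ (Fin 3))⟫ = 0 := by
  classical
  have hUc : Continuous U := hU.continuous
  set e₀ : EuclideanSpace ℝ (Fin 3) := EuclideanSpace.single 0 1 with he₀
  set V : EuclideanSpace ℝ (Fin 3) → EuclideanSpace ℝ (Fin 3) := fun y => ∫ ζ in (0 : ℝ)..P, U (y + ζ • eZ) with hV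
  have hVd : ∀ y, HasFDerivAt V (∫ ζ in (0 : ℝ)..P, fderiv ℝ U (y + ζ • eZ)) y := fun y =>
    hasFDerivAt_periodAverage_pdp hU hDU y
  have hVdiff : Differentiable ℝ V := fun y => (hVd y).differentiableAt
  have hVax : IsAxisymmetric V := fun θ y => periodAverage_rotZ_pdp hUc hax θ y
  have hVz : ∀ (y : EuclideanSpace ℝ (Fin 3)) (s : ℝ), V (y + s • eZ) = V y := fun y s =>
    periodAverage_add_smul_eZ_pdp hper y s
  have hVdiv : ∀ y, VectorCalculus.divergence V y = 0 := fun y => divergence_periodAverage_pdp hU hDU hdiv y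
  -- `DV(y)[e_z] = 0`
  have hDVz : ∀ y, fderiv ℝ V y eZ = 0 := by
    intro y
    have hline : HasDerivAt (fun s : ℝ => y + s • (eZ : EuclideanSpace ℝ (Fin 3))) eZ 0 := by
      have h := ((hasDerivAt_id (0 : ℝ)).smul_const (eZ : EuclideanSpace ℝ (Fin 3))).const_add y
      simpa using h
    have hy0 : y + (0 : ℝ) • (eZ : EuclideanSpace ℝ (Fin 3)) = y := by simp
    have hd' : DifferentiableAt ℝ V (y + (0 : ℝ) • (eZ : EuclideanSpace ℝ (Fin 3))) := by rw [hy0]; exact hVdiff y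
    have hcomp := hd'.hasFDerivAt.comp_hasDerivAt (0 : ℝ) hline
    rw [hy0] at hcomp
    have hconst : HasDerivAt (fun s : ℝ => V (y + s • (eZ : EuclideanSpace ℝ (Fin 3)))) 0 0 := by
      have : (fun s : ℝ => V (y + s • (eZ : EuclideanSpace ℝ (Fin 3)))) = fun _ => V y := funext (hVz y)
      rw [this]; exact hasDerivAt_const _ _
    exact hcomp.unique hconst
  -- the divergence in coordinates: `(DV e₀)₀ + (DV e₁)₁ = 0`
  set e₁ : EuclideanSpace ℝ (Fin 3) := EuclideanSpace.single 1 1 with he₁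
  have hdiv01 : ∀ y, fderiv ℝ V y e₀ 0 + fderiv ℝ V y e₁ 1 = 0 := by
    intro y
    have h := hVdiv y
    rw [divergence_eq_sum_inner_fderiv (EuclideanSpace.basisFun (Fin 3) ℝ), Fin.sum_univ_three] at h
    have hb : ∀ i : Fin 3, (EuclideanSpace.basisFun (Fin 3) ℝ) i = EuclideanSpace.single i 1 := fun i => by
      simp [EuclideanSpace.basisFun_apply]
    simp only [hb] at h
    have h2 : (EuclideanSpace.single (2 : Fin 3) (1 : ℝ) : EuclideanSpace ℝ (Fin 3)) = eZ := rfl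
    rw [h2, hDVz y, inner_zero_right, add_zero, EuclideanSpace.inner_single_left,
      EuclideanSpace.inner_single_left] at h
    simpa [he₀, he₁] using h
  -- infinitesimal axisymmetry at `y = t e₀`: `t (DV e₁)₁ = V₀`
  have hrot : ∀ s : ℝ, s * fderiv ℝ V (s • e₀) e₁ 1 = V (s • e₀) 0 := by
    intro s
    have h := hVax.fderiv_rotGen (x := s • e₀) (hVdiff _)
    have hJ : rotGen (s • e₀) = s • e₁ := by
      ext i
      fin_cases i <;> simp [rotGen, he₀, he₁]
    rw [hJ, map_smul] at h
    have h1 := congrArg (fun w : EuclideanSpace ℝ (Fin 3) => w 1) h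
    simp only [PiLp.smul_apply, smul_eq_mul, rotGen_apply_one] at h1
    exact h1
  -- the function `g(s) = ⟪V(s e₀), s e₀⟫ = s V₀(s e₀)` has zero derivative
  have hg : ∀ s : ℝ, ⟪V (s • e₀), s • e₀⟫ = s * V (s • e₀) 0 := fun s => by
    rw [real_inner_smul_right, he₀, EuclideanSpace.inner_single_right]
    simp
  have hray : ∀ s : ℝ, HasDerivAt (fun s : ℝ => s • e₀) e₀ s := fun s => by
    simpa using (hasDerivAt_id s).smul_const e₀
  have hV0d : ∀ s : ℝ, HasDerivAt (fun s : ℝ => V (s • e₀) 0) (fderiv ℝ V (s • e₀) e₀ 0) s := by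
    intro s
    have h1 : HasDerivAt (fun s : ℝ => V (s • e₀)) (fderiv ℝ V (s • e₀) e₀) s :=
      (hVdiff _).hasFDerivAt.comp_hasDerivAt s (hray s)
    exact (EuclideanSpace.proj (𝕜 := ℝ) (0 : Fin 3)).hasFDerivAt.comp_hasDerivAt s h1
  have hgd : ∀ s : ℝ, HasDerivAt (fun s : ℝ => s * V (s • e₀) 0) 0 s := by
    intro s
    have h : HasDerivAt (fun s : ℝ => s * V (s • e₀) 0)
        (1 * V (s • e₀) 0 + s * fderiv ℝ V (s • e₀) e₀ 0) s := (hasDerivAt_id' s).mul (hV0d s)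
    have hzero : 1 * V (s • e₀) 0 + s * fderiv ℝ V (s • e₀) e₀ 0 = 0 := by
      have h1 := hdiv01 (s • e₀)
      have h2 := hrot s
      linear_combination s * h1 - h2
    rwa [hzero] at h
  have hconst := is_const_of_deriv_eq_zero (f := fun s : ℝ => s * V (s • e₀) 0)
    (fun s => (hgd s).differentiableAt) (fun s => (hgd s).deriv) t 0
  rw [hg, hconst]
  simp

/-- **The period average of `r U_r` vanishes** (the compatibility behind the periodicity of the
angular stream function in Lei–Ren–Zhang, §§2–3): for `U ∈ C¹` with bounded derivative,
divergence free, axisymmetric and axially `P`-periodic,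
`∫_0^P ⟪U(x_h + ζ e_z), x_h⟫ dζ = 0` for every `x`. [cite: LeiRenZhang2019, §2 (2.5) and §3 (3.4) (the z-periodic angular stream function L_θ with v_r = −∂_z L_θ), arXiv pp. 5, 7] -/
theorem intervalIntegral_inner_horizPart_eq_zero (hU : ContDiff ℝ 1 U) {C1 : ℝ}
    (hDU : ∀ x, ‖fderiv ℝ U x‖ ≤ C1) (hdiv : VectorCalculus.IsDivFree U) (hax : IsAxisymmetric U)
    (hper : IsAxiallyPeriodic P U) (x : EuclideanSpace ℝ (Fin 3)) :
    ∫ ζ in (0 : ℝ)..P, ⟪U (horizPart x + ζ • eZ), horizPart x⟫ = 0 := by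
  have hUc : Continuous U := hU.continuous
  set y : EuclideanSpace ℝ (Fin 3) := horizPart x with hy
  have hy2 : y 2 = 0 := horizPart_apply_two x
  -- `⟪∫U, y⟫ = ∫⟪U, y⟫`
  have hswap : ∫ ζ in (0 : ℝ)..P, ⟪U (y + ζ • eZ), y⟫ = ⟪∫ ζ in (0 : ℝ)..P, U (y + ζ • eZ), y⟫ := by
    have hi : IntervalIntegrable (fun ζ : ℝ => U (y + ζ • eZ)) volume 0 P :=
      (hUc.comp (continuous_const.add (continuous_id.smul continuous_const) :
        Continuous fun ζ : ℝ => y + ζ • (eZ : EuclideanSpace ℝ (Fin 3)))).intervalIntegrable 0 P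
    have h := (innerSL ℝ y).intervalIntegral_comp_comm hi
    simp only [innerSL_apply_apply] at h
    rw [real_inner_comm, ← h]
    exact intervalIntegral.integral_congr fun ζ _ => real_inner_comm _ _
  rw [hswap]
  -- polar angle: `y = R_θ (r e₀)`
  obtain ⟨θ, hθ⟩ := exists_eq_rotZ_smul_pdp hy2
  set t : ℝ := cylRadius y with ht
  rw [hθ, periodAverage_rotZ_pdp hUc hax θ, inner_rotZ_rotZ_pdp]
  exact inner_periodAverage_ray_pdp hU hDU hdiv hax hper t

end Average

/-! ### Periodicity and the global bound -/

/-- **The potential is axially periodic** for a smooth bounded-derivative divergence-free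
axisymmetric axially `P`-periodic drift: `Φ(x + Pe_z) − Φ(x) = ∫_0^P ⟪U(x_h + ζe_z), x_h⟫ dζ = 0`. [cite: LeiRenZhang2019, §2 (2.5) and §3 (3.4), (3.15) (the z-periodic angular stream function L_θ − L_θ(r,0,t)), arXiv pp. 5, 7, 8] -/
theorem isAxiallyPeriodic_axialDriftPotential {P : ℝ} (hU : ContDiff ℝ 1 U) {C1 : ℝ}
    (hDU : ∀ x, ‖fderiv ℝ U x‖ ≤ C1) (hdiv : VectorCalculus.IsDivFree U) (hax : IsAxisymmetric U)
    (hper : IsAxiallyPeriodic P U) : IsAxiallyPeriodic P (axialDriftPotential U) := by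
  have hUc : Continuous U := hU.continuous
  intro x
  show axialDriftPotential U (x + P • eZ) = axialDriftPotential U x
  rw [axialDriftPotential_add_smul_eZ_pdp, axialDriftPotential]
  have hf := continuous_integrand_pdp hUc (horizPart x) (horizPart x)
  have hp : Function.Periodic (fun ζ : ℝ => ⟪U (horizPart x + ζ • eZ), horizPart x⟫) P := fun ζ => by
    have e : horizPart x + (ζ + P) • eZ = (horizPart x + ζ • eZ) + P • eZ := by rw [add_smul, add_assoc]
    simp only [e]
    exact congrArg (fun v => ⟪v, horizPart x⟫) (hper (horizPart x + ζ • eZ))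
  rw [← intervalIntegral.integral_add_adjacent_intervals (hf.intervalIntegrable 0 (x 2))
    (hf.intervalIntegrable (x 2) (x 2 + P)), hp.intervalIntegral_add_eq (x 2) 0, zero_add,
    intervalIntegral_inner_horizPart_eq_zero hU hDU hdiv hax hper x, add_zero]

/-- **The global bound `|Φ(x)| ≤ C_U P r`** for a periodic potential (reduce `x₂` modulo `P`). [cite: LeiRenZhang2019, §3 (3.4) (boundedness of L_θ − L_θ(r,0,t), "v_r ∈ (L^∞)^{-1}"), arXiv p. 7] -/
theorem abs_axialDriftPotential_le_mul_cylRadius {P : ℝ} (hP : 0 < P) {CU : ℝ}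
    (hUb : ∀ x, ‖U x‖ ≤ CU) (hΦp : IsAxiallyPeriodic P (axialDriftPotential U))
    (x : EuclideanSpace ℝ (Fin 3)) :
    |axialDriftPotential U x| ≤ CU * P * cylRadius x := by
  have hCU : 0 ≤ CU := (norm_nonneg _).trans (hUb 0)
  -- reduce to `x₂ ∈ [0, P)`
  set k : ℤ := ⌊x 2 / P⌋ with hk
  set x' : EuclideanSpace ℝ (Fin 3) := x + ((-k : ℤ) * P : ℝ) • eZ with hx'
  have hper : axialDriftPotential U x' = axialDriftPotential U x := by
    rw [hx']
    exact hΦp.periodic_int_mul_smul_eZ (-k) x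
  have hx'2 : x' 2 = x 2 - k * P := by
    rw [hx', add_smul_eZ_apply_two_pdp]; push_cast; ring
  have h0 : 0 ≤ x' 2 := by
    rw [hx'2]
    have := Int.floor_le (x 2 / P)
    rw [← hk] at this
    nlinarith [mul_le_mul_of_nonneg_right this hP.le, div_mul_cancel₀ (x 2) hP.ne']
  have h1 : x' 2 ≤ P := by
    rw [hx'2]
    have := Int.lt_floor_add_one (x 2 / P)
    rw [← hk] at this
    have h' : x 2 < (k + 1) * P := by
      calc x 2 = x 2 / P * P := by field_simp
        _ < (k + 1) * P := mul_lt_mul_of_pos_right this hP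
    linarith
  have hr : cylRadius x' = cylRadius x := by
    rw [hx', ← norm_horizPart, horizPart_add_smul_eZ, norm_horizPart]
  rw [← hper]
  calc |axialDriftPotential U x'| ≤ CU * |x' 2| * cylRadius x' := abs_axialDriftPotential_le hUb x'
    _ ≤ CU * P * cylRadius x := by
        rw [hr, abs_of_nonneg h0]
        exact mul_le_mul_of_nonneg_right (mul_le_mul_of_nonneg_left h1 hCU) (cylRadius_nonneg x)

end LeiRenZhang2019

end Literature.Analysis.FluidPDE

end
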